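import Mathlib.RingTheory.Nullstellensatz
import Mathlib.RingTheory.Flat.Basic
import Mathlib.RingTheory.TensorProduct.Free
import Mathlib.RingTheory.TensorProduct.Maps
import Mathlib.RingTheory.FiniteType
import Mathlib.RingTheory.Nilpotent.Defs
import Mathlib.RingTheory.TensorProduct.Nontrivial
import HarnessLib

/-!
# Tensor products of domains over an algebraically closed field are domains

Let `k` be an algebraically closed field and `A`, `B` commutative `k`-algebras which are integral
domains. Then `B ⊗ₖ A` is an integral domain
(`Literature.FieldTheory.Regular.isDomain_tensorProduct_of_isAlgClosed`). Geometrically: the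
product of two irreducible varieties over an algebraically closed field is irreducible; in the
language of regular extensions (Lang, *Algebra*, VIII §4): every extension of an algebraically
closed field is regular, and `K ⊗ₖ L` is a domain for `K/k` regular and `L/k` arbitrary.

## Proof

The classical specialisation argument. By flatness of `A` over the field `k` it suffices to treat
`S ⊗ₖ A` for finitely generated subalgebras `S ⊆ B`
(`Literature.FieldTheory.Regular.noZeroDivisors_tensorProduct_of_forall_fg`). Fix a `k`-basis
`(aᵢ)` of `A`; it is an `S`-basis of `S ⊗ₖ A`, so `u ∈ S ⊗ₖ A` has coordinates `uᵢ ∈ S`. Every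
`k`-point `φ : S → k` of `S` induces `ψ_φ : S ⊗ₖ A → A`, `s ⊗ a ↦ φ(s) a`, and `ψ_φ(u) = 0` iff
`φ(uᵢ) = 0` for all `i`. If `u v = 0` then, `A` being a domain, every point `φ` kills all `uᵢ` or
all `vⱼ`, hence all products `uᵢ vⱼ`; by Hilbert's Nullstellensatz an element of a finitely
generated `k`-algebra vanishing at every `k`-point is nilpotent
(`Literature.FieldTheory.Regular.isNilpotent_of_forall_algHom_apply_eq_zero`), so `uᵢ vⱼ = 0` in
the domain `S`, whence `u = 0` or `v = 0`.

## References

* S. Lang, *Algebra*, 3rd ed., GTM 211, Springer 2002, VIII §4 (regular extensions; Cor. 4.14).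
* O. Zariski, P. Samuel, *Commutative Algebra* I, Ch. III §15, Thm 40 and Cor.
-/

open scoped TensorProduct

namespace Literature.FieldTheory.Regular

/-! ### Points of finitely generated algebras over an algebraically closed field -/

/-- **Nullstellensatz, point form.** In a finitely generated commutative algebra `S` over an
algebraically closed field `k`, an element on which every `k`-algebra homomorphism `S → k`
vanishes is nilpotent (write `S = k[X₁,…,Xₙ]/I`; the `k`-points of `S` are the points of `Z(I)`,
and `I(Z(I)) = √I`, Mathlib's `MvPolynomial.vanishingIdeal_zeroLocus_eq_radical`). [folklore] -/
theorem isNilpotent_of_forall_algHom_apply_eq_zero {k S : Type*} [Field k] [IsAlgClosed k]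
    [CommRing S] [Algebra k S] [Algebra.FiniteType k S] (s : S)
    (hs : ∀ φ : S →ₐ[k] k, φ s = 0) : IsNilpotent s := by
  obtain ⟨n, f, hf⟩ := Algebra.FiniteType.iff_quotient_mvPolynomial''.1 ‹Algebra.FiniteType k S›
  obtain ⟨p, rfl⟩ := hf s
  set I : Ideal (MvPolynomial (Fin n) k) := RingHom.ker f.toRingHom with hI
  -- every point of `Z(I)` gives a `k`-point of `S`
  have hvan : p ∈ MvPolynomial.vanishingIdeal k (MvPolynomial.zeroLocus k I) := by
    rw [MvPolynomial.mem_vanishingIdeal_iff]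
    intro x hx
    have hkill : ∀ a ∈ I, MvPolynomial.aeval x a = 0 := fun a ha =>
      (MvPolynomial.mem_zeroLocus_iff.1 hx) a ha
    let e : (MvPolynomial (Fin n) k ⧸ I) ≃ₐ[k] S := Ideal.quotientKerAlgEquivOfSurjective hf
    let φ : S →ₐ[k] k := (Ideal.Quotient.liftₐ I (MvPolynomial.aeval x) hkill).comp e.symm
    have hφ : φ (f p) = MvPolynomial.aeval x p := by
      have : e.symm (f p) = Ideal.Quotient.mk I p :=
        Ideal.quotientKerAlgEquivOfSurjective_symm_apply hf p
      change Ideal.Quotient.liftₐ I (MvPolynomial.aeval x) hkill (e.symm (f p)) = _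
      rw [this]
      rfl
    rw [← hφ]
    exact hs φ
  rw [MvPolynomial.vanishingIdeal_zeroLocus_eq_radical] at hvan
  obtain ⟨N, hN⟩ := hvan
  refine ⟨N, ?_⟩
  rw [← map_pow]
  have : p ^ N ∈ RingHom.ker f.toRingHom := hN
  exact this

/-! ### Reduction to finitely generated subalgebras -/

/-- If `S ⊗_R A` has no zero divisors for every finitely generated subalgebra `S ⊆ B` and `A` is
flat over `R`, then `B ⊗_R A` has no zero divisors (two elements of `B ⊗_R A` come from some
`S ⊗_R A`, which embeds by flatness). [folklore] -/
theorem noZeroDivisors_tensorProduct_of_forall_fg {R A B : Type*} [CommRing R] [CommRing A]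
    [CommRing B] [Algebra R A] [Algebra R B] [Module.Flat R A]
    (h : ∀ S : Subalgebra R B, S.FG → NoZeroDivisors (S ⊗[R] A)) : NoZeroDivisors (B ⊗[R] A) := by
  classical
  refine ⟨fun {x y} hxy => ?_⟩
  obtain ⟨sx, hx⟩ := TensorProduct.exists_finset x
  obtain ⟨sy, hy⟩ := TensorProduct.exists_finset y
  set S : Subalgebra R B := Algebra.adjoin R ↑(sx.image Prod.fst ∪ sy.image Prod.fst) with hS
  have hSfg : S.FG := Subalgebra.fg_adjoin_finset _
  have hmemx : ∀ p ∈ sx, p.1 ∈ S := fun p hp =>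
    Algebra.subset_adjoin (Finset.mem_coe.2 (Finset.mem_union_left _ (Finset.mem_image_of_mem _ hp)))
  have hmemy : ∀ p ∈ sy, p.1 ∈ S := fun p hp =>
    Algebra.subset_adjoin (Finset.mem_coe.2 (Finset.mem_union_right _ (Finset.mem_image_of_mem _ hp)))
  -- the inclusion `S ⊗ A → B ⊗ A` is injective by flatness
  let ι : S ⊗[R] A →ₐ[R] B ⊗[R] A := Algebra.TensorProduct.map S.val (AlgHom.id R A)
  have hι : Function.Injective ι := by
    have : (ι : S ⊗[R] A → B ⊗[R] A) = LinearMap.rTensor A S.val.toLinearMap := by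
      ext z
      induction z using TensorProduct.induction_on with
      | zero => simp
      | tmul s a => simp [ι]
      | add u v hu hv => rw [map_add, map_add, hu, hv]
    rw [this]
    exact Module.Flat.rTensor_preserves_injective_linearMap _ Subtype.val_injective
  -- lifts of `x` and `y`
  let x' : S ⊗[R] A := ∑ p ∈ sx.attach, (⟨p.1.1, hmemx p.1 p.2⟩ : S) ⊗ₜ[R] p.1.2
  let y' : S ⊗[R] A := ∑ p ∈ sy.attach, (⟨p.1.1, hmemy p.1 p.2⟩ : S) ⊗ₜ[R] p.1.2
  have hx' : ι x' = x := by
    simp only [x', map_sum, ι, Algebra.TensorProduct.map_tmul, Subalgebra.coe_val, AlgHom.coe_id, id_eq]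
    rw [hx]
    exact Finset.sum_attach sx (fun p => p.1 ⊗ₜ[R] p.2)
  have hy' : ι y' = y := by
    simp only [y', map_sum, ι, Algebra.TensorProduct.map_tmul, Subalgebra.coe_val, AlgHom.coe_id, id_eq]
    rw [hy]
    exact Finset.sum_attach sy (fun p => p.1 ⊗ₜ[R] p.2)
  haveI := h S hSfg
  have hprod : x' * y' = 0 := hι (by rw [map_mul, hx', hy', hxy, map_zero])
  rcases eq_zero_or_eq_zero_of_mul_eq_zero hprod with h0 | h0
  · left; rw [← hx', h0, map_zero]
  · right; rw [← hy', h0, map_zero]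

/-! ### The theorem -/

/-- **Specialisation at a point.** For a `k`-algebra homomorphism `φ : S → k`, the induced
`ψ_φ : S ⊗ₖ A → A`, `s ⊗ a ↦ φ(s) a`, kills `u` iff `φ` kills all coordinates of `u` in the
`S`-basis `1 ⊗ aᵢ` of `S ⊗ₖ A` coming from a `k`-basis `(aᵢ)` of `A`. [folklore] -/
theorem lift_apply_eq_zero_iff {k S A : Type*} [Field k] [CommRing S] [Algebra k S] [CommRing A]
    [Algebra k A] {ι : Type*} (b : Module.Basis ι k A) (φ : S →ₐ[k] k) (u : S ⊗[k] A) :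
    Algebra.TensorProduct.lift ((Algebra.ofId k A).comp φ) (AlgHom.id k A) (fun _ _ => Commute.all _ _) u = 0 ↔
      ∀ i, φ ((Algebra.TensorProduct.basis S b).repr u i) = 0 := by
  classical
  set ψ := Algebra.TensorProduct.lift ((Algebra.ofId k A).comp φ) (AlgHom.id k A)
    (fun _ _ => Commute.all _ _) with hψ
  set bS := Algebra.TensorProduct.basis S b with hbS
  -- `u = ∑ cᵢ ⊗ aᵢ`
  have hu : u = (bS.repr u).sum fun i c => c ⊗ₜ[k] b i := by
    conv_lhs => rw [← bS.linearCombination_repr u, Finsupp.linearCombination_apply]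
    refine Finsupp.sum_congr fun i _ => ?_
    rw [hbS, Algebra.TensorProduct.basis_apply, TensorProduct.smul_tmul', smul_eq_mul, mul_one]
  -- `ψ u = ∑ φ(cᵢ) • aᵢ`
  have hψu : ψ u = Finsupp.linearCombination k b ((bS.repr u).mapRange φ (map_zero φ)) := by
    conv_lhs => rw [hu]
    rw [Finsupp.linearCombination_apply,
      Finsupp.sum_mapRange_index (h := fun i (a : k) => a • b i) (fun _ => zero_smul k _),
      Finsupp.sum, map_sum, Finsupp.sum]
    refine Finset.sum_congr rfl fun i _ => ?_
    rw [hψ, Algebra.TensorProduct.lift_tmul, AlgHom.comp_apply, AlgHom.coe_id, id_eq, Algebra.ofId_apply,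
      Algebra.smul_def]
  rw [hψu]
  constructor
  · intro h0 i
    have hinj : Function.Injective (Finsupp.linearCombination k b) := b.linearIndependent
    have := hinj (h0.trans (map_zero _).symm)
    have := DFunLike.congr_fun this i
    simpa using this
  · intro h0
    have : (bS.repr u).mapRange φ (map_zero φ) = 0 := by
      ext i; simpa using h0 i
    rw [this, map_zero]

/-- **Tensor products of domains over an algebraically closed field are domains** (Lang,
*Algebra* VIII §4, Cor. 4.14; Zariski–Samuel I, III §15): for `k` algebraically closed and
`k`-algebras `A`, `B` which are integral domains, `B ⊗ₖ A` is an integral domain. (Reduce to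
`S ⊗ₖ A`, `S ⊆ B` finitely generated; if `u v = 0`, every `k`-point of `S` kills all coordinates
of `u` or all of `v`, hence all products `uᵢ vⱼ`, which are therefore nilpotent by the
Nullstellensatz, i.e. zero.) [cite: Lang2002, VIII §4] -/
theorem isDomain_tensorProduct_of_isAlgClosed (k A B : Type*) [Field k] [IsAlgClosed k]
    [CommRing A] [IsDomain A] [Algebra k A] [CommRing B] [IsDomain B] [Algebra k B] :
    IsDomain (B ⊗[k] A) := by
  classical
  haveI : Nontrivial (B ⊗[k] A) :=
    Algebra.TensorProduct.nontrivial_of_algebraMap_injective_of_isDomain k B A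
      (FaithfulSMul.algebraMap_injective k B) (FaithfulSMul.algebraMap_injective k A)
  haveI : NoZeroDivisors (B ⊗[k] A) := by
    refine noZeroDivisors_tensorProduct_of_forall_fg fun S hS => ?_
    haveI : Algebra.FiniteType k S := S.fg_iff_finiteType.1 hS
    let b := Module.Free.chooseBasis k A
    let bS := Algebra.TensorProduct.basis (↥S) b
    refine ⟨fun {u v} huv => ?_⟩
    -- every point kills all coordinates of `u` or all coordinates of `v`
    have key : ∀ (φ : S →ₐ[k] k) (i j), φ (bS.repr u i * bS.repr v j) = 0 := by
      intro φ i j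
      set ψ := Algebra.TensorProduct.lift ((Algebra.ofId k A).comp φ) (AlgHom.id k A)
        (fun _ _ => Commute.all _ _) with hψ
      have h0 : ψ u * ψ v = 0 := by rw [← map_mul, huv, map_zero]
      rw [map_mul]
      rcases eq_zero_or_eq_zero_of_mul_eq_zero h0 with h1 | h1
      · rw [(lift_apply_eq_zero_iff b φ u).1 h1 i, zero_mul]
      · rw [(lift_apply_eq_zero_iff b φ v).1 h1 j, mul_zero]
    have hzero : ∀ i j, bS.repr u i * bS.repr v j = 0 := by
      intro i j
      haveI : IsReduced S := isReduced_of_injective S.val Subtype.val_injective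
      exact (isNilpotent_of_forall_algHom_apply_eq_zero _ (fun φ => key φ i j)).eq_zero
    by_cases hu : ∀ i, bS.repr u i = 0
    · left
      exact bS.repr.injective (by ext i; simp [hu i])
    · right
      push Not at hu
      obtain ⟨i, hi⟩ := hu
      refine bS.repr.injective ?_
      ext j
      have := hzero i j
      rcases eq_zero_or_eq_zero_of_mul_eq_zero this with h | h
      · exact absurd h hi
      · simp [h]
  exact NoZeroDivisors.to_isDomain _

end Literature.FieldTheory.Regular
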